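import Summits.CriticalPhenomena.PercolationContinuityZ3.Theorems.PercNearOneGluingNoHeavyLowerTailSahiCoordinateTwoThirdsFiveCube
import Mathlib.Tactic.Ring
import Mathlib.Tactic.Linarith
import Mathlib.Tactic.NormNum
import Mathlib.Tactic.FinCases
import HarnessLib

/-!
# `NoHeavyLowerTail` (crux stmt-CriticalPhenomena-4575): the HUB TRIPLE — an exact extremal family of the two-level laws,
# with fibre `E_3(μ_{p[0↦s]}) = (1−s)²·E_3(μ_{p[0↦0]})` identically, and the cleanest refutation of every chord comparison

Support file (cell `prim-masterthm`, seat P2, generation 19; `--supports stmt-CriticalPhenomena-4575`).  No `sorry`, no definitions beyond the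
three witness events, standard axioms.  Technique of `…SahiCoordinateTwoThirdsFiveCube` (transport to the Boolean cube, coin peeling, `simp`
with `decide`), here with SYMBOLIC biases and `ring`.

THE FAMILY.  On four coins with the hub `x₀` and three independent "petals" `x₁, x₂, x₃`:
  `A = x₁ ∧ (x₀ ∨ x₂ ∨ x₃)`,  `B = x₂`,  `C = x₃ ∧ (x₀ ∨ x₁ ∨ x₂)`  (all increasing).
Along the hub the `1`-sections `(x₁, x₂, x₃)` are independent (so `E_3 = 0` there) and the `0`-sections are `(x₁(x₂∨x₃), x₂, x₃(x₁∨x₂))`.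
**`sahiE_three_hub`: for EVERY product measure `μ_p`,  `E_3(μ_p; A,B,C) = (1 − p₀)² · κ(p)`,  `κ(p) = p₁p₂p₃(1−p₁)(1−p₂)²(1−p₃)`** — the
fibre along the hub is EXACTLY `bot·(1−s)²` (`sahiE_three_hub_update`): both facets and the whole cubic are explicit.

CONSEQUENCES (all biases, exact):
* the Bernstein row of the fibre is `bot·(1, 1/3, 0, 0)`, so the two-level laws `3β₁ ≥ β₀` (`SahiTwoLevelMinus`, MC1) and `3β₂ ≥ β₃` (`SahiTwoLevelPlus`,
  MC2) of `…SahiTwoLevelC3` — census-clean and sufficient for Kahn's Conjecture 5 — hold with EQUALITY at the hub, with a POSITIVE bottom facet: an exact,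
  four-coin equality case of both laws (the lineage knew the shape `(1−s)²` as a LIMIT of the doubled star's sparse corner; here it is an identity);
* `hub_chord_eq`: the sectional chord `(1−p₀)·E_3(μ_{p[0↦0]}) + p₀·E_3(μ_{p[0↦1]}) = (1−p₀)·κ = E_3(μ_p)/(1−p₀)`; hence **no per-coin chord bound
  `chord ≤ C·E_3` holds for any constant `C`** (`chord_gt_mul`: take `p₀ > 1 − 1/C`), and **the chord-sum bound `Σ_e chord_e ≤ (m+1)·E_3` fails already on
  four coins** (`not_chordSumBound_four`: at `p ≡ (9/10, 1/2, 1/2, 1/2)` the hub chord alone is `10·E_3 > 5·E_3`, the other chords being `≥ 0` by the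
  closed form) — compare `…SahiChordBoundsFalse` (six coins, one bias, kernel arithmetic); each of these bounds would have implied Kahn's conjecture by a
  one-line induction, and each was tight-but-true in every random census on `≤ 6` coins (SAHI-ROUTE.md §4.43);
* what survives at the hub: the slice minimum principle (`min` facet `= 0 ≤ E_3`) and the two-level laws (with equality).
HONEST FRAMING: identities and refutations of strengthenings; Kahn's `C_3`, `SahiTwoLevelPlus/Minus` and the slice minimum principle remain OPEN.
Axioms standard. [this work]
-/

noncomputable section

open scoped Classical

namespace Summit.CriticalPhenomena.PercolationContinuityZ3.Theorems

namespace SahiTwoLevelHub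

open Finset Function Literature.Combinatorics.Sahi2008
open Literature.Probability.Percolation.DecisionTree (ind ind_of_mem ind_of_not_mem ind_nonneg)
open SahiBlockExchangeable (cubeEquivSet mem_cubeEquivSet bernoulliWeight_comp_cubeEquivSet)
open SahiChordSuperlinear (sum_cube_succ sum_cube_zero)
open SahiCoordinateTwoThirds (ex_bernoulliWeight_eq_sum_cube)

/-! ### 1. The hub triple on four coins -/

/-- `A = x₁ ∧ (x₀ ∨ x₂ ∨ x₃)`. [this work] -/
def hubA : Set (Set (Fin 4)) := {S | (1 : Fin 4) ∈ S ∧ ((0 : Fin 4) ∈ S ∨ (2 : Fin 4) ∈ S ∨ (3 : Fin 4) ∈ S)}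

/-- `B = x₂`. [this work] -/
def hubB : Set (Set (Fin 4)) := {S | (2 : Fin 4) ∈ S}

/-- `C = x₃ ∧ (x₀ ∨ x₁ ∨ x₂)`. [this work] -/
def hubC : Set (Set (Fin 4)) := {S | (3 : Fin 4) ∈ S ∧ ((0 : Fin 4) ∈ S ∨ (1 : Fin 4) ∈ S ∨ (2 : Fin 4) ∈ S)}

/-- `A` is increasing. [this work] -/
theorem isUpperSet_hubA : IsUpperSet hubA := by
  intro S T hST h
  exact ⟨hST h.1, h.2.imp (fun h0 => hST h0) (fun h' => h'.imp (fun h2 => hST h2) (fun h3 => hST h3))⟩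

/-- `B` is increasing. [this work] -/
theorem isUpperSet_hubB : IsUpperSet hubB := by
  intro S T hST h
  exact hST h

/-- `C` is increasing. [this work] -/
theorem isUpperSet_hubC : IsUpperSet hubC := by
  intro S T hST h
  exact ⟨hST h.1, h.2.imp (fun h0 => hST h0) (fun h' => h'.imp (fun h1 => hST h1) (fun h2 => hST h2))⟩

/-- The positive constant `κ(p) = p₁p₂p₃(1−p₁)(1−p₂)²(1−p₃)` (the `0`-facet value `E_3(μ_{p[0↦0]})`). [this work] -/
def kappa (p : Fin 4 → unitInterval) : ℝ :=
  (p 1 : ℝ) * (p 2 : ℝ) * (p 3 : ℝ) * (1 - (p 1 : ℝ)) * (1 - (p 2 : ℝ)) ^ 2 * (1 - (p 3 : ℝ))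

/-- `κ(p) ≥ 0`. [this work] -/
theorem kappa_nonneg (p : Fin 4 → unitInterval) : 0 ≤ kappa p := by
  unfold kappa
  have h1 := (p 1).2.1; have h1' := (p 1).2.2; have h2 := (p 2).2.1; have h2' := (p 2).2.2
  have h3 := (p 3).2.1; have h3' := (p 3).2.2
  have a : 0 ≤ 1 - ((p 1 : unitInterval) : ℝ) := by linarith
  have b : 0 ≤ 1 - ((p 3 : unitInterval) : ℝ) := by linarith
  positivity

/-! ### 2. The closed form -/

set_option maxHeartbeats 4000000 in
-- symbolic evaluation of the seven moments over the 16-point cube; nothing else is affected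
/-- **`E_3(μ_p; A, B, C) = (1 − p₀)²·κ(p)` for every product measure on four coins.** [this work] -/
theorem sahiE_three_hub (p : Fin 4 → unitInterval) :
    sahiE (bernoulliWeight p) 3 ![ind hubA, ind hubB, ind hubC] = (1 - (p 0 : ℝ)) ^ 2 * kappa p := by
  rw [sahiE_three, kappa]
  simp only [ex_bernoulliWeight_eq_sum_cube, Pi.mul_apply, ind, hubA, hubB, hubC, Set.mem_setOf_eq, mem_cubeEquivSet,
    sum_cube_succ, sum_cube_zero, coinWeight, Fin.prod_univ_succ, Fin.prod_univ_zero, Matrix.cons_val_zero, Matrix.cons_val_one,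
    Matrix.cons_val, Matrix.cons_val_succ, Fin.isValue, Fin.succ_zero_eq_one, Fin.succ_one_eq_two]
  simp (config := { decide := true }) only [if_true, if_false]
  have h3 : (Fin.succ (2 : Fin 3)) = (3 : Fin 4) := rfl
  simp only [h3]
  ring

/-- **The fibre along the hub is exactly `bot·(1−s)²`**: `E_3(μ_{p[0↦s]}) = (1 − s)²·κ(p)` for every `s ∈ [0,1]`. [this work] -/
theorem sahiE_three_hub_update (p : Fin 4 → unitInterval) (s : unitInterval) :
    sahiE (bernoulliWeight (update p 0 s)) 3 ![ind hubA, ind hubB, ind hubC] = (1 - (s : ℝ)) ^ 2 * kappa p := by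
  rw [sahiE_three_hub]
  simp [kappa, update_self, update_of_ne]

/-- The top facet vanishes: `E_3(μ_{p[0↦1]}) = 0` (the `1`-sections `x₁, x₂, x₃` are independent). [this work] -/
theorem sahiE_three_hub_top (p : Fin 4 → unitInterval) :
    sahiE (bernoulliWeight (update p 0 1)) 3 ![ind hubA, ind hubB, ind hubC] = 0 := by
  rw [sahiE_three_hub_update]; simp

/-- The bottom facet is `κ(p)`: `E_3(μ_{p[0↦0]}) = κ(p)`. [this work] -/
theorem sahiE_three_hub_bot (p : Fin 4 → unitInterval) :
    sahiE (bernoulliWeight (update p 0 0)) 3 ![ind hubA, ind hubB, ind hubC] = kappa p := by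
  rw [sahiE_three_hub_update]; simp

/-- **The sectional chord along the hub is `(1 − p₀)·κ(p)`** (`= E_3(μ_p)/(1−p₀)` when `p₀ < 1`). [this work] -/
theorem hub_chord_eq (p : Fin 4 → unitInterval) :
    (1 - (p 0 : ℝ)) * sahiE (bernoulliWeight (update p 0 0)) 3 ![ind hubA, ind hubB, ind hubC] +
        (p 0 : ℝ) * sahiE (bernoulliWeight (update p 0 1)) 3 ![ind hubA, ind hubB, ind hubC] = (1 - (p 0 : ℝ)) * kappa p := by
  rw [sahiE_three_hub_bot, sahiE_three_hub_top]; ring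

/-- **Two-level equality**: in Bernstein form the fibre `(1−s)²κ` has row `κ·(1, 1/3, 0, 0)`, i.e. `2E_3(μ_{p[0↦0]}) + ∂_s E_3|_{s=0} = 0`
(`3β₁ = β₀`) and `3β₂ = β₃ = 0`; stated here as the polynomial identity `(1−s)²κ = κ(1−s)³ + 3·(κ/3)·s(1−s)² + 3·0·s²(1−s) + 0·s³`. [this work] -/
theorem hub_bernstein_row (p : Fin 4 → unitInterval) (s : unitInterval) :
    sahiE (bernoulliWeight (update p 0 s)) 3 ![ind hubA, ind hubB, ind hubC] =
      kappa p * (1 - (s : ℝ)) ^ 3 + 3 * (kappa p / 3) * (s : ℝ) * (1 - (s : ℝ)) ^ 2 + 3 * 0 * (s : ℝ) ^ 2 * (1 - (s : ℝ)) +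
        0 * (s : ℝ) ^ 3 := by
  rw [sahiE_three_hub_update]; ring

/-! ### 3. Refutations of the chord comparisons -/

/-- The bias vector `(t, 1/2, 1/2, 1/2)`. [this work] -/
def hubBias (t : unitInterval) : Fin 4 → unitInterval := ![t, ⟨1/2, by norm_num, by norm_num⟩, ⟨1/2, by norm_num, by norm_num⟩,
  ⟨1/2, by norm_num, by norm_num⟩]

/-- `κ = 1/128` at petal biases `1/2`. [this work] -/
theorem kappa_hubBias (t : unitInterval) : kappa (hubBias t) = 1 / 128 := by
  simp [kappa, hubBias]; norm_num

/-- **No per-coin chord bound**: for every constant `C` there are a product measure with biases in `(0,1)` and three increasing events with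
`E_3 > 0` whose sectional chord along the hub exceeds `C·E_3`. [this work] -/
theorem chord_gt_mul (C : ℝ) :
    ∃ (p : Fin 4 → unitInterval) (A B D : Set (Set (Fin 4))) (a : Fin 4), IsUpperSet A ∧ IsUpperSet B ∧ IsUpperSet D ∧
      (∀ i, 0 < ((p i : unitInterval) : ℝ) ∧ ((p i : unitInterval) : ℝ) < 1) ∧ 0 < sahiE (bernoulliWeight p) 3 ![ind A, ind B, ind D] ∧
      C * sahiE (bernoulliWeight p) 3 ![ind A, ind B, ind D] <
        (1 - ((p a : unitInterval) : ℝ)) * sahiE (bernoulliWeight (update p a 0)) 3 ![ind A, ind B, ind D] +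
          ((p a : unitInterval) : ℝ) * sahiE (bernoulliWeight (update p a 1)) 3 ![ind A, ind B, ind D] := by
  -- hub bias t = 1 − 1/(|C|+2) ∈ (0,1): then C·(1−t)²κ < (1−t)κ since C(1−t) = C/(|C|+2) < 1
  set u : ℝ := 1 / (|C| + 2) with hu
  have hCpos : 0 < |C| + 2 := by positivity
  have hu0 : 0 < u := by rw [hu]; positivity
  have hu1 : u < 1 := by rw [hu, div_lt_one hCpos]; linarith [abs_nonneg C]
  have ht : (1 - u) ∈ unitInterval := ⟨by linarith, by linarith⟩
  refine ⟨hubBias ⟨1 - u, ht⟩, hubA, hubB, hubC, 0, isUpperSet_hubA, isUpperSet_hubB, isUpperSet_hubC, ?_, ?_, ?_⟩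
  · intro i
    fin_cases i <;> simp [hubBias] <;> (try constructor) <;> (try norm_num) <;> linarith
  · rw [sahiE_three_hub, kappa_hubBias]
    have : ((hubBias ⟨1 - u, ht⟩ 0 : unitInterval) : ℝ) = 1 - u := rfl
    rw [this]; nlinarith
  · rw [hub_chord_eq, sahiE_three_hub, kappa_hubBias]
    have h0 : ((hubBias ⟨1 - u, ht⟩ 0 : unitInterval) : ℝ) = 1 - u := rfl
    rw [h0]
    have hCu : C * u < 1 := by
      have : C * u ≤ |C| * u := by nlinarith [le_abs_self C]
      have : |C| * u < 1 := by
        rw [hu, ← mul_div_assoc, mul_one, div_lt_one hCpos]; linarith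
      linarith
    nlinarith

/-- **The chord-sum bound fails on four coins**: at `p = (9/10, 1/2, 1/2, 1/2)` the four sectional chords of the hub triple sum to more than
`(4+1)·E_3(μ_p) > 0` (the hub chord alone is `10·E_3`). [this work] -/
theorem not_chordSumBound_four :
    ∃ (p : Fin 4 → unitInterval) (A B D : Set (Set (Fin 4))), IsUpperSet A ∧ IsUpperSet B ∧ IsUpperSet D ∧
      (∀ i, 0 < ((p i : unitInterval) : ℝ) ∧ ((p i : unitInterval) : ℝ) < 1) ∧ 0 < sahiE (bernoulliWeight p) 3 ![ind A, ind B, ind D] ∧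
      ((4 : ℕ) + 1 : ℝ) * sahiE (bernoulliWeight p) 3 ![ind A, ind B, ind D] <
        ∑ a : Fin 4, ((1 - ((p a : unitInterval) : ℝ)) * sahiE (bernoulliWeight (update p a 0)) 3 ![ind A, ind B, ind D] +
          ((p a : unitInterval) : ℝ) * sahiE (bernoulliWeight (update p a 1)) 3 ![ind A, ind B, ind D]) := by
  have h9 : (9 / 10 : ℝ) ∈ unitInterval := ⟨by norm_num, by norm_num⟩
  refine ⟨hubBias ⟨9 / 10, h9⟩, hubA, hubB, hubC, isUpperSet_hubA, isUpperSet_hubB, isUpperSet_hubC, ?_, ?_, ?_⟩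
  · intro i
    fin_cases i <;> simp [hubBias] <;> norm_num
  · rw [sahiE_three_hub, kappa_hubBias]
    have : ((hubBias ⟨9 / 10, h9⟩ 0 : unitInterval) : ℝ) = 9 / 10 := rfl
    rw [this]; norm_num
  · -- every chord is ≥ 0 by the closed form (facet values are (1−p₀')²κ(p') ≥ 0); the hub chord is (1/10)·κ = 10·E_3
    have hfac : ∀ (a : Fin 4) (b : unitInterval),
        0 ≤ sahiE (bernoulliWeight (update (hubBias ⟨9 / 10, h9⟩) a b)) 3 ![ind hubA, ind hubB, ind hubC] := by
      intro a b
      rw [sahiE_three_hub]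
      exact mul_nonneg (sq_nonneg _) (kappa_nonneg _)
    have hsum : (1 - ((hubBias ⟨9 / 10, h9⟩ 0 : unitInterval) : ℝ)) *
          sahiE (bernoulliWeight (update (hubBias ⟨9 / 10, h9⟩) 0 0)) 3 ![ind hubA, ind hubB, ind hubC] +
        ((hubBias ⟨9 / 10, h9⟩ 0 : unitInterval) : ℝ) *
          sahiE (bernoulliWeight (update (hubBias ⟨9 / 10, h9⟩) 0 1)) 3 ![ind hubA, ind hubB, ind hubC] ≤
        ∑ a : Fin 4, ((1 - ((hubBias ⟨9 / 10, h9⟩ a : unitInterval) : ℝ)) *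
            sahiE (bernoulliWeight (update (hubBias ⟨9 / 10, h9⟩) a 0)) 3 ![ind hubA, ind hubB, ind hubC] +
          ((hubBias ⟨9 / 10, h9⟩ a : unitInterval) : ℝ) *
            sahiE (bernoulliWeight (update (hubBias ⟨9 / 10, h9⟩) a 1)) 3 ![ind hubA, ind hubB, ind hubC]) := by
      rw [Fin.sum_univ_four]
      have t1 := hfac 1 0; have t1' := hfac 1 1; have t2 := hfac 2 0; have t2' := hfac 2 1; have t3 := hfac 3 0; have t3' := hfac 3 1
      have q1 : 0 ≤ ((hubBias ⟨9 / 10, h9⟩ 1 : unitInterval) : ℝ) ∧ ((hubBias ⟨9 / 10, h9⟩ 1 : unitInterval) : ℝ) ≤ 1 := (hubBias _ 1).2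
      have q2 : 0 ≤ ((hubBias ⟨9 / 10, h9⟩ 2 : unitInterval) : ℝ) ∧ ((hubBias ⟨9 / 10, h9⟩ 2 : unitInterval) : ℝ) ≤ 1 := (hubBias _ 2).2
      have q3 : 0 ≤ ((hubBias ⟨9 / 10, h9⟩ 3 : unitInterval) : ℝ) ∧ ((hubBias ⟨9 / 10, h9⟩ 3 : unitInterval) : ℝ) ≤ 1 := (hubBias _ 3).2
      nlinarith [mul_nonneg (sub_nonneg.2 q1.2) t1, mul_nonneg q1.1 t1', mul_nonneg (sub_nonneg.2 q2.2) t2, mul_nonneg q2.1 t2',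
        mul_nonneg (sub_nonneg.2 q3.2) t3, mul_nonneg q3.1 t3']
    have hhub : (1 - ((hubBias ⟨9 / 10, h9⟩ 0 : unitInterval) : ℝ)) *
          sahiE (bernoulliWeight (update (hubBias ⟨9 / 10, h9⟩) 0 0)) 3 ![ind hubA, ind hubB, ind hubC] +
        ((hubBias ⟨9 / 10, h9⟩ 0 : unitInterval) : ℝ) *
          sahiE (bernoulliWeight (update (hubBias ⟨9 / 10, h9⟩) 0 1)) 3 ![ind hubA, ind hubB, ind hubC] = (1 / 10) * (1 / 128) := by
      rw [hub_chord_eq, kappa_hubBias]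
      have : ((hubBias ⟨9 / 10, h9⟩ 0 : unitInterval) : ℝ) = 9 / 10 := rfl
      rw [this]; norm_num
    have hval : sahiE (bernoulliWeight (hubBias ⟨9 / 10, h9⟩)) 3 ![ind hubA, ind hubB, ind hubC] = (1 / 100) * (1 / 128) := by
      rw [sahiE_three_hub, kappa_hubBias]
      have : ((hubBias ⟨9 / 10, h9⟩ 0 : unitInterval) : ℝ) = 9 / 10 := rfl
      rw [this]; norm_num
    rw [hval]; push_cast; linarith

end SahiTwoLevelHub

end Summit.CriticalPhenomena.PercolationContinuityZ3.Theorems
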